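import Summits.AtomisticToContinuum.HydrodynamicLimit.Theorems.DiffuseBackwardInfluence.Negative.TransferKernels

/-!
# `DiffuseBackwardInfluence`: free directions — a velocity changes only along its OWN collision normals
(negative knowledge / load-bearing analysis for crux stmt-AtomisticToContinuum-12950, 2/2)

From the standing disprover's `Cruxes/DiffuseBackwardInfluence/Disproof.lean`
(refuter-cdisprove-stmt-AtomisticToContinuum-12950-0), on top of `Negative/TransferKernels.lean`.

Along the crux's fold, particle `i`'s velocity changes only by multiples of the realised normals of the steps
that touch `i`. Hence for every input field `W` and every vector `e` orthogonal to those normals,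
`⟪transfer W i, e⟫ = ⟪W i, e⟫` (`inner_transfer_of_spares`: in block form `Π_V M_ii = Π_V`, `Π_V M_ik = 0`
for `k ≠ i`, `V = (own normals)ᗮ`). Consequences proved here:

* a unit direction free of `i`'s own normals keeps `a_ii = ‖M_ii‖_F² ≥ 1`, so `rowIpr_i ≥ 1`
  (`one_le_rowIpr_of_free_direction`); two vectors never span `ℝ³` (`exists_unit_orth_two`), so EVERY particle
  with at most two collisions in the window has `rowIpr_i ≥ 1` (`one_le_rowIpr_of_mem_lowCollSet`) — the bound
  is tight at three orthonormal own normals with fresh partners (`M_ii = 0`);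
* pointwise `ipr ≥` (fraction of particles with `≤ 2` collisions in the window) (`lowCollFrac_le_ipr`), hence the
  crux IMPLIES FewCollisionsRare for `m ≤ 2` in mean along the non-equilibrium law
  (`fewLowColl_of_diffuseBackwardInfluence`), strengthening `fewIdle_of_diffuseBackwardInfluence` (`m = 0`):
  a necessary condition every proof must establish, and a refutation handle.
-/

namespace Summit.AtomisticToContinuum.HydrodynamicLimit.Theorems.DiffuseBackwardInfluenceNeg

open scoped BigOperators Topology ENNReal InnerProductSpace
open Filter Set MeasureTheory
open Literature.Analysis.FluidPDE Literature.MathematicalPhysics.KineticTheory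
open Summit.AtomisticToContinuum.HydrodynamicLimit.Theses.CollisionIsometryCLT

noncomputable section

section FreeDirection

variable {σ : ℝ} {N : ℕ}

/-- A step that either does not touch `i` or has its realised normal orthogonal to `e` preserves the
`e`-component of particle `i`'s velocity. [folklore] -/
theorem inner_step_of_spares {y : Cfg N} {k : ℕ} {i : Fin (N + 1)} {e : V3}
    (hk : (∀ h : (pairsAt σ N y k).Nonempty, i ≠ h.some.1 ∧ i ≠ h.some.2) ∨ ⟪normalAt σ N y k, e⟫_ℝ = 0)
    (W : Fin (N + 1) → V3) : ⟪step σ N y W k i, e⟫_ℝ = ⟪W i, e⟫_ℝ := by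
  rcases hk with hk | hk
  · rw [step_apply_of_ne hk]
  · exact inner_step_of_orth hk W i

/-- **`v_i` changes only along `i`'s own collision normals.** If every step of the window that touches `i`
has its realised normal orthogonal to `e`, the `e`-component of particle `i`'s output equals the
`e`-component of its input, for EVERY input field. [folklore] -/
theorem inner_transfer_of_spares {y : Cfg N} {Δ : ℝ} {i : Fin (N + 1)} {e : V3}
    (hS : ∀ k < colls σ N y Δ,
      (∀ h : (pairsAt σ N y k).Nonempty, i ≠ h.some.1 ∧ i ≠ h.some.2) ∨ ⟪normalAt σ N y k, e⟫_ℝ = 0)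
    (W : Fin (N + 1) → V3) : ⟪transfer σ N y Δ W i, e⟫_ℝ = ⟪W i, e⟫_ℝ := by
  unfold transfer
  have key : ∀ L : List ℕ, (∀ k ∈ L,
      (∀ h : (pairsAt σ N y k).Nonempty, i ≠ h.some.1 ∧ i ≠ h.some.2) ∨ ⟪normalAt σ N y k, e⟫_ℝ = 0) →
      ∀ W : Fin (N + 1) → V3, ⟪(L.foldl (step σ N y) W) i, e⟫_ℝ = ⟪W i, e⟫_ℝ := by
    intro L hL
    induction L with
    | nil => intro W; rfl
    | cons k L ih =>
      intro W
      rw [List.foldl_cons, ih (fun k' hk' => hL k' (List.mem_cons_of_mem _ hk')),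
        inner_step_of_spares (hL k List.mem_cons_self)]
  exact key _ (fun k hk => hS k (List.mem_range.1 hk)) W

/-- **A free unit direction keeps the self-block heavy: `rowIpr_i ≥ 1`.** If a unit vector `e` is orthogonal to
the realised normals of all steps touching `i`, then `a_ii ≥ Σ_a ⟪M_ii e_a, e⟫² = ‖e‖² = 1` and
`rowIpr_i ≥ a_ii² ≥ 1`. [folklore] -/
theorem one_le_rowIpr_of_free_direction {y : Cfg N} {Δ : ℝ} (i : Fin (N + 1)) {e : V3} (he : ‖e‖ = 1)
    (hS : ∀ k < colls σ N y Δ,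
      (∀ h : (pairsAt σ N y k).Nonempty, i ≠ h.some.1 ∧ i ≠ h.some.2) ∨ ⟪normalAt σ N y k, e⟫_ℝ = 0) :
    1 ≤ rowIpr σ N y Δ i := by
  let g : Fin (N + 1) → Fin 3 → ℝ := fun k a =>
    ‖transfer σ N y Δ (Pi.single k (EuclideanSpace.single a (1 : ℝ))) i‖ ^ 2
  have hcomp : ∀ a : Fin 3, (e a) ^ 2 ≤ g i a := by
    intro a
    have hinner : ⟪transfer σ N y Δ (Pi.single i (EuclideanSpace.single a (1 : ℝ))) i, e⟫_ℝ = e a := by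
      rw [inner_transfer_of_spares hS, Pi.single_eq_same]
      simp [EuclideanSpace.inner_single_left]
    have hcs := abs_real_inner_le_norm
      (transfer σ N y Δ (Pi.single i (EuclideanSpace.single a (1 : ℝ))) i) e
    rw [hinner, he, mul_one] at hcs
    calc (e a) ^ 2 = |e a| ^ 2 := (sq_abs _).symm
      _ ≤ ‖transfer σ N y Δ (Pi.single i (EuclideanSpace.single a (1 : ℝ))) i‖ ^ 2 :=
          pow_le_pow_left₀ (abs_nonneg _) hcs 2
  have hnorm : ∑ a : Fin 3, (e a) ^ 2 = 1 := by
    have h2 := EuclideanSpace.norm_eq e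
    rw [he] at h2
    have h3 : ∑ a : Fin 3, ‖e a‖ ^ 2 = 1 := by
      have := congrArg (fun x : ℝ => x ^ 2) h2
      simp only [one_pow] at this
      rw [Real.sq_sqrt (Finset.sum_nonneg fun a _ => by positivity)] at this
      exact this.symm
    simpa [Real.norm_eq_abs, sq_abs] using h3
  have hrow : 1 ≤ ∑ a : Fin 3, g i a := by
    rw [← hnorm]
    exact Finset.sum_le_sum fun a _ => hcomp a
  have hsq : 1 ≤ (∑ a : Fin 3, g i a) ^ 2 := one_le_pow₀ hrow
  have hfin : (∑ a : Fin 3, g i a) ^ 2 ≤ ∑ k : Fin (N + 1), (∑ a : Fin 3, g k a) ^ 2 :=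
    Finset.single_le_sum (f := fun k => (∑ a : Fin 3, g k a) ^ 2) (fun k _ => sq_nonneg _)
      (Finset.mem_univ i)
  change 1 ≤ ∑ k : Fin (N + 1), (∑ a : Fin 3, g k a) ^ 2
  exact hsq.trans hfin

/-- The particles touched by at most two steps of the window (own-collision count `≤ 2`). -/
def lowCollSet (σ : ℝ) (N : ℕ) (y : Cfg N) (Δ : ℝ) : Set (Fin (N + 1)) :=
  {i | ∃ k₁ k₂ : ℕ, ∀ k < colls σ N y Δ, ∀ h : (pairsAt σ N y k).Nonempty,
    (i = h.some.1 ∨ i = h.some.2) → (k = k₁ ∨ k = k₂)}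

/-- Membership in `lowCollSet`, unfolded. [folklore] -/
theorem mem_lowCollSet {y : Cfg N} {Δ : ℝ} {i : Fin (N + 1)} :
    i ∈ lowCollSet σ N y Δ ↔ ∃ k₁ k₂ : ℕ, ∀ k < colls σ N y Δ, ∀ h : (pairsAt σ N y k).Nonempty,
      (i = h.some.1 ∨ i = h.some.2) → (k = k₁ ∨ k = k₂) :=
  Iff.rfl

/-- Two vectors of `ℝ³` have a common unit normal (two vectors never span `ℝ³`). [folklore] -/
theorem exists_unit_orth_two (u v : V3) : ∃ e : V3, ‖e‖ = 1 ∧ ⟪u, e⟫_ℝ = 0 ∧ ⟪v, e⟫_ℝ = 0 := by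
  set U : Submodule ℝ V3 := Submodule.span ℝ ({u, v} : Set V3) with hUdef
  have hU : Module.finrank ℝ U ≤ 2 := by
    have h := finrank_span_finset_le_card (R := ℝ) (M := V3) ({u, v} : Finset V3)
    rw [Finset.coe_pair] at h
    exact h.trans Finset.card_le_two
  have hperp : 0 < Module.finrank ℝ Uᗮ := by
    have h := Submodule.finrank_add_finrank_orthogonal U
    have h3 : Module.finrank ℝ V3 = 3 := by simp
    omega
  have hne : Uᗮ ≠ ⊥ := by
    intro hbot
    rw [hbot, finrank_bot] at hperp
    exact lt_irrefl 0 hperp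
  obtain ⟨e, heU, hne0⟩ := Submodule.exists_mem_ne_zero_of_ne_bot hne
  have hnorm : ‖e‖ ≠ 0 := norm_ne_zero_iff.2 hne0
  have hu : u ∈ U := Submodule.subset_span (by simp)
  have hv : v ∈ U := Submodule.subset_span (by simp)
  refine ⟨‖e‖⁻¹ • e, ?_, ?_, ?_⟩
  · rw [norm_smul, norm_inv, norm_norm, inv_mul_cancel₀ hnorm]
  · rw [inner_smul_right, Submodule.inner_right_of_mem_orthogonal hu heU, mul_zero]
  · rw [inner_smul_right, Submodule.inner_right_of_mem_orthogonal hv heU, mul_zero]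

/-- **Particles with at most two collisions in the window keep `rowIpr ≥ 1`.** [folklore] -/
theorem one_le_rowIpr_of_mem_lowCollSet {y : Cfg N} {Δ : ℝ} {i : Fin (N + 1)}
    (h2 : i ∈ lowCollSet σ N y Δ) : 1 ≤ rowIpr σ N y Δ i := by
  obtain ⟨k₁, k₂, hk⟩ := mem_lowCollSet.1 h2
  obtain ⟨e, he, h1, h2'⟩ := exists_unit_orth_two (normalAt σ N y k₁) (normalAt σ N y k₂)
  refine one_le_rowIpr_of_free_direction i he fun k hkc => ?_
  by_cases hown : ∀ h : (pairsAt σ N y k).Nonempty, i ≠ h.some.1 ∧ i ≠ h.some.2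
  · exact Or.inl hown
  · right
    obtain ⟨h, hh⟩ := not_forall.1 hown
    have hor : i = h.some.1 ∨ i = h.some.2 := by
      by_cases hi1 : i = h.some.1
      · exact Or.inl hi1
      by_cases hi2 : i = h.some.2
      · exact Or.inr hi2
      · exact absurd ⟨hi1, hi2⟩ hh
    rcases hk k hkc h hor with rfl | rfl
    · exact h1
    · exact h2'

/-- The number of particles with at most two own collisions in the window. -/
def lowCollCount (σ : ℝ) (N : ℕ) (y : Cfg N) (Δ : ℝ) : ℕ :=
  Nat.card (lowCollSet σ N y Δ)

/-- The fraction of particles with at most two own collisions in the window. -/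
def lowCollFrac (σ : ℝ) (N : ℕ) (y : Cfg N) (Δ : ℝ) : ℝ :=
  (lowCollCount σ N y Δ : ℝ) / ((N + 1 : ℕ) : ℝ)

/-- `#{i : ≤ 2 own collisions} ≤ Σ_i rowIpr_i`. [folklore] -/
theorem lowCollCount_le (σ : ℝ) (N : ℕ) (y : Cfg N) (Δ : ℝ) :
    (lowCollCount σ N y Δ : ℝ) ≤ ∑ i : Fin (N + 1), rowIpr σ N y Δ i := by
  classical
  have hcount : lowCollCount σ N y Δ = (Finset.univ.filter fun i => i ∈ lowCollSet σ N y Δ).card := by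
    unfold lowCollCount
    rw [Nat.card_eq_fintype_card, ← Fintype.card_subtype]
  rw [hcount]
  calc ((Finset.univ.filter fun i => i ∈ lowCollSet σ N y Δ).card : ℝ)
        = ∑ i ∈ Finset.univ.filter (fun i => i ∈ lowCollSet σ N y Δ), (1 : ℝ) := by
          rw [Finset.sum_const, nsmul_eq_mul, mul_one]
    _ ≤ ∑ i ∈ Finset.univ.filter (fun i => i ∈ lowCollSet σ N y Δ), rowIpr σ N y Δ i :=
          Finset.sum_le_sum fun i hi => one_le_rowIpr_of_mem_lowCollSet (Finset.mem_filter.1 hi).2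
    _ ≤ ∑ i, rowIpr σ N y Δ i :=
          Finset.sum_le_sum_of_subset_of_nonneg (Finset.filter_subset _ _)
            fun i _ _ => rowIpr_nonneg σ N y Δ i

/-- **Pointwise: `ipr ≥` fraction of particles with `≤ 2` collisions in the window.** [folklore] -/
theorem lowCollFrac_le_ipr (σ : ℝ) (N : ℕ) (y : Cfg N) (Δ : ℝ) :
    lowCollFrac σ N y Δ ≤ ipr σ N y Δ := by
  unfold lowCollFrac ipr
  have hN : (0 : ℝ) < ((N + 1 : ℕ) : ℝ) := by positivity
  rw [div_eq_mul_inv, mul_comm]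
  exact mul_le_mul_of_nonneg_left (lowCollCount_le σ N y Δ) (inv_nonneg.2 hN.le)

end FreeDirection

/-- FewCollisionsRare for `m ≤ 2`, in mean: along every admissible window the local-Gibbs-evolved expected
fraction of particles with at most two collisions in the window tends to `0`. -/
def FewLowColl : Prop :=
  ∀ (a₀ θ₀ : T3 → ℝ) (u₀ : T3 → V3), Continuous a₀ → Continuous θ₀ → Continuous u₀ →
    (∀ x, 0 < a₀ x) → (∀ x, 0 < θ₀ x) →
    ∃ σ₀ : ℝ, 0 < σ₀ ∧ ∀ σ : ℝ, 0 < σ → σ < σ₀ →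
      ∀ Φ : (N : ℕ) → HardSphereFlow (Torus.geometry (Fin 3)) (hsDiameter σ N) (N + 1),
      ∀ Δ : ℕ → ℝ, (∀ N, 0 < Δ N) → Tendsto Δ atTop (𝓝 0) →
        Tendsto (fun N : ℕ => Δ N * ((N + 1 : ℕ) : ℝ) ^ ((1 : ℝ) / 3)) atTop atTop →
        ∀ t : ℝ, 0 < t →
          Tendsto (fun N : ℕ => ∫⁻ z, ENNReal.ofReal (lowCollFrac σ N ((Φ N).flow (t - Δ N) z) (Δ N))
            ∂(localGibbsLaw σ a₀ u₀ θ₀ N (Φ N))) atTop (𝓝 0)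

/-- **The crux implies FewCollisionsRare for `m ≤ 2` in mean**: any proof of the crux proves that the expected
fraction of particles suffering at most two collisions in the window vanishes on every admissible window,
uniformly along the non-equilibrium law (strengthens `fewIdle_of_diffuseBackwardInfluence`). [folklore] -/
theorem fewLowColl_of_diffuseBackwardInfluence (h : DiffuseBackwardInfluence) : FewLowColl := by
  change (∀ (a₀ θ₀ : T3 → ℝ) (u₀ : T3 → V3), Continuous a₀ → Continuous θ₀ → Continuous u₀ →
        (∀ x, 0 < a₀ x) → (∀ x, 0 < θ₀ x) →
        ∃ σ₀ : ℝ, 0 < σ₀ ∧ ∀ σ : ℝ, 0 < σ → σ < σ₀ →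
          ∀ Φ : (N : ℕ) → HardSphereFlow (Torus.geometry (Fin 3)) (hsDiameter σ N) (N + 1),
          ∀ Δ : ℕ → ℝ, (∀ N, 0 < Δ N) → Tendsto Δ atTop (𝓝 0) →
            Tendsto (fun N : ℕ => Δ N * ((N + 1 : ℕ) : ℝ) ^ ((1 : ℝ) / 3)) atTop atTop →
            ∀ t : ℝ, 0 < t →
              Tendsto (fun N : ℕ => ∫⁻ z, ENNReal.ofReal (ipr σ N ((Φ N).flow (t - Δ N) z) (Δ N))
                ∂(localGibbsLaw σ a₀ u₀ θ₀ N (Φ N))) atTop (𝓝 0)) at h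
  intro a₀ θ₀ u₀ ha hθ hu ha0 hθ0
  obtain ⟨σ₀, hσ₀, hσ⟩ := h a₀ θ₀ u₀ ha hθ hu ha0 hθ0
  refine ⟨σ₀, hσ₀, fun σ hσp hσlt Φ Δ hΔp hΔ0 hΔg t ht => ?_⟩
  have hipr := hσ σ hσp hσlt Φ Δ hΔp hΔ0 hΔg t ht
  refine tendsto_of_tendsto_of_tendsto_of_le_of_le tendsto_const_nhds hipr (fun N => zero_le) fun N => ?_
  exact lintegral_mono fun z => ENNReal.ofReal_le_ofReal (lowCollFrac_le_ipr _ _ _ _)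

end

end Summit.AtomisticToContinuum.HydrodynamicLimit.Theorems.DiffuseBackwardInfluenceNeg
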